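import Summits.CriticalPhenomena.SAWScalingLimit.Theorems.SAWDevelopingMapObservableToSLECanonicalTransferDiscretisation
import Literature.Probability.RandomPlanarGeometry.HullSubdomainPullback
import Literature.Probability.RandomPlanarGeometry.CaratheodoryHalfPlaneProofs
import Literature.Probability.RandomPlanarGeometry.RestrictionHullsRiemannProofs
import Literature.Probability.RandomPlanarGeometry.RestrictionHullsProofs
import Literature.Probability.RandomPlanarGeometry.JordanDomainProofs
import HarnessLib

/-!
# Crux `SAWDevelopingMap.ObservableToSLE` (stmt-CriticalPhenomena-10472), line
`floor-ratio-restriction-bootstrap`, stub `stub_canonicalTransfer`: the `D'`-side insensitivity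
(M2'b) of the discretisation input FROM HULL APPROXIMATION

Landing target:
`Summits/CriticalPhenomena/SAWScalingLimit/Theorems/SAWDevelopingMapObservableToSLECanonicalTransferInsensitivityB.lean`
(`--supports stmt-CriticalPhenomena-10472`).  (M2'b) `Z_{Λ''δ}/Z_{Λ'δ} → 1` for the transparent
data of `discretisation_core` is reduced to HULL APPROXIMATION FROM OUTSIDE of the hull subdomain
`D'` (a `D'' ⊇ D'` swallowing a metric collar of `D'` with `Φ'_{A''}(0)^{5/8} ≤ (1+ε) Φ'_A(0)^{5/8}`):
the margin lemma puts `Λ'' δ` inside the inner family of `D''`, the cocycle for `(Λ, Λ')`, `(Λ, Λ_{D''})`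
squeezes the ratio.  Contents: `eventually_im_lt_of_endpointApprox`, `pair_admissible`,
`eventually_subset_of_margin`, `tendsto_one_of_ratio_squeeze` (= registered sub-goal
`stub_canonicalTransfer_ratioSqueeze`), `insensitivity_of_hullApprox`.
-/

noncomputable section

open scoped Topology
open Filter Set Metric
open Literature.Probability.LatticeModels (HexVertex hexGraph hexCenter Site)
open Literature.Probability.RandomPlanarGeometry
open Literature.Probability.RandomPlanarGeometry.SAW
open Literature.Probability.Percolation (PathIn)

namespace Summit.CriticalPhenomena.SAWScalingLimit.Theorems.ObservableToSLE.FloorRatio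

/-! ### (M2'b) from hull approximation -/

section Insensitivity

open UpperHalfPlane (upperHalfPlaneSet)

/-- The floor condition at a smaller radius, from flatness and the height bound. [folklore] -/
theorem inter_ball_eq_of_flat {S : Set ℂ} {hgt R : ℝ} {p : ℂ} (hS : S ⊆ {z : ℂ | hgt < z.im})
    (hfl : {z : ℂ | hgt < z.im} ∩ ball p R ⊆ S) : S ∩ ball p R = {z : ℂ | hgt < z.im} ∩ ball p R :=
  Set.ext fun _ => ⟨fun hz => ⟨hS hz.1, hz.2⟩, fun hz => ⟨hfl hz, hz.2⟩⟩

/-- The canonical endpoints lie strictly above the floor line, eventually (they are vertices of the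
canonical discrete domain, whose vertices are points of `D`). [folklore] -/
theorem eventually_im_lt_of_endpointApprox {D : DobrushinDomain} {a b : ℝ → HexVertex}
    (hDh : D.carrier ⊆ {z : ℂ | (D.pt 0).im < z.im}) (hab : IsEmbEndpointApprox hexGraph hexCenter D a b) :
    ∀ᶠ δ : ℝ in 𝓝[>] 0, (D.pt 0).im < ((δ : ℂ) * hexCenter (a δ)).im ∧
      (D.pt 0).im < ((δ : ℂ) * hexCenter (b δ)).im := by
  have hne := eventually_ne_of_tendsto_nhds (D.pt_injective.ne (by decide : (0 : Fin 2) ≠ 1))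
    hab.tendsto_fst hab.tendsto_snd
  filter_upwards [hab.reachable, hne] with δ hReach hab'
  have hab'' : a δ ≠ b δ := fun h => hab' (by rw [h])
  obtain ⟨wa, hwa⟩ := exists_adj_of_reachable hReach hab''
  obtain ⟨wb, hwb⟩ := exists_adj_of_reachable hReach.symm hab''.symm
  exact ⟨hDh (embMeshDomain_subset _ _ _ _ (mem_embMeshDomain_of_adj hwa)),
    hDh (embMeshDomain_subset _ _ _ _ (mem_embMeshDomain_of_adj hwb))⟩

/-- **Admissibility of a pair of inner families** (the `∀ᶠ δ` clause of the cocycle): the inner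
family `L` of the floor domain `D` and that of a subdomain `E ⊆ D` flat near the floor points, with
the floor mid-edges under the canonical endpoints. [folklore] -/
theorem pair_admissible {D : DobrushinDomain} {E : Set ℂ} {ρ' : ℝ} {a b : ℝ → HexVertex}
    {m : ℝ → ℤ} {v₀ : ℝ → HexVertex} {L LE : ℝ → Finset HexVertex} {σa σb : ℝ → Sym2 HexVertex}
    (hpt : (D.pt 1).im = (D.pt 0).im) (hDh : D.carrier ⊆ {z : ℂ | (D.pt 0).im < z.im})
    (hρ'0 : 0 < ρ')
    (hED : E ⊆ D.carrier)
    (hm : ∀ δ : ℝ, 0 < δ → ((m δ : ℝ) - 2 / 3) * (δ * (Real.sqrt 3 / 2)) ≤ (D.pt 0).im ∧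
      (D.pt 0).im < ((m δ : ℝ) + 1 / 3) * (δ * (Real.sqrt 3 / 2)))
    (ha_t : Tendsto (fun δ : ℝ => (δ : ℂ) * hexCenter (a δ)) (𝓝[>] 0) (𝓝 (D.pt 0)))
    (hb_t : Tendsto (fun δ : ℝ => (δ : ℂ) * hexCenter (b δ)) (𝓝[>] 0) (𝓝 (D.pt 1)))
    (haim : ∀ᶠ δ : ℝ in 𝓝[>] 0, (D.pt 0).im < ((δ : ℂ) * hexCenter (a δ)).im ∧
      (D.pt 0).im < ((δ : ℂ) * hexCenter (b δ)).im)
    (hend' : ∀ᶠ δ : ℝ in 𝓝[>] 0,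
      (∃ u : HexVertex, hexGraph.Adj (a δ) u ∧ ((δ : ℂ) * hexCenter u).im ≤ (D.pt 0).im) ∧
      (∃ u : HexVertex, hexGraph.Adj (b δ) u ∧ ((δ : ℂ) * hexCenter u).im ≤ (D.pt 1).im))
    (hσa : ∀ᶠ δ : ℝ in 𝓝[>] 0, σa δ = s(a δ, if (a δ).2 = 0 then
      (((a δ).1 - Pi.single 1 1, 1) : HexVertex) else ((a δ).1 + Pi.single 1 1, 0)))
    (hσb : ∀ᶠ δ : ℝ in 𝓝[>] 0, σb δ = s(b δ, if (b δ).2 = 0 then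
      (((b δ).1 - Pi.single 1 1, 1) : HexVertex) else ((b δ).1 + Pi.single 1 1, 0)))
    (hL : ∀ᶠ δ : ℝ in 𝓝[>] 0, hexDomainSimplyConnected (L δ) ∧
      (hexGraph.induce (↑(L δ) : Set HexVertex)).Preconnected ∧
      ∀ z : HexVertex, z ∈ L δ ↔ PathIn hexGraph
        {u : HexVertex | (δ : ℂ) * hexCenter u ∈ D.carrier ∧ m δ ≤ u.1 1 ∧
          closedBall ((δ : ℂ) * hexCenter u) (25 * δ) ∩ {z : ℂ | (D.pt 0).im < z.im} ⊆
            D.carrier ∪ ball (D.pt 0) (12 * ρ') ∪ ball (D.pt 1) (12 * ρ')} (v₀ δ) z)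
    (hLrows : ∀ᶠ δ : ℝ in 𝓝[>] 0, ∀ v : HexVertex,
      (δ : ℂ) * hexCenter v ∈ ball (D.pt 0) ρ' ∪ ball (D.pt 1) ρ' → m δ ≤ v.1 1 → v ∈ L δ)
    (hLE : ∀ᶠ δ : ℝ in 𝓝[>] 0, hexDomainSimplyConnected (LE δ) ∧
      (hexGraph.induce (↑(LE δ) : Set HexVertex)).Preconnected ∧
      ∀ z : HexVertex, z ∈ LE δ ↔ PathIn hexGraph
        {u : HexVertex | (δ : ℂ) * hexCenter u ∈ E ∧ m δ ≤ u.1 1 ∧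
          closedBall ((δ : ℂ) * hexCenter u) (25 * δ) ∩ {z : ℂ | (D.pt 0).im < z.im} ⊆
            E ∪ ball (D.pt 0) (12 * ρ') ∪ ball (D.pt 1) (12 * ρ')} (v₀ δ) z)
    (hLErows : ∀ᶠ δ : ℝ in 𝓝[>] 0, ∀ v : HexVertex,
      (δ : ℂ) * hexCenter v ∈ ball (D.pt 0) ρ' ∪ ball (D.pt 1) ρ' → m δ ≤ v.1 1 → v ∈ LE δ) :
    ∀ᶠ δ : ℝ in 𝓝[>] 0,
    LE δ ⊆ L δ ∧ hexDomainSimplyConnected (L δ) ∧ hexDomainSimplyConnected (LE δ) ∧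
    (hexGraph.induce (↑(L δ) : Set HexVertex)).Preconnected ∧
    (hexGraph.induce (↑(LE δ) : Set HexVertex)).Preconnected ∧
    σa δ ∈ hexDomainBoundary (L δ) ∧ σb δ ∈ hexDomainBoundary (L δ) ∧
    σa δ ∈ hexDomainBoundary (LE δ) ∧ σb δ ∈ hexDomainBoundary (LE δ) ∧
    Nonempty (HexMidEdgeSAW (LE δ) (σa δ) (σb δ)) ∧
    (∀ v ∈ L δ, (δ : ℂ) * hexCenter v ∈ D.carrier ∧ m δ ≤ v.1 1) ∧
    (∀ v ∈ LE δ, (δ : ℂ) * hexCenter v ∈ E) ∧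
    (∀ v : HexVertex, (δ : ℂ) * hexCenter v ∈ ball (D.pt 0) ρ' ∪ ball (D.pt 1) ρ' →
    ((v ∈ L δ ↔ m δ ≤ v.1 1) ∧ (v ∈ LE δ ↔ m δ ≤ v.1 1))) := by
  have hSS : ∀ δ : ℝ, {u : HexVertex | (δ : ℂ) * hexCenter u ∈ E ∧ m δ ≤ u.1 1 ∧
      closedBall ((δ : ℂ) * hexCenter u) (25 * δ) ∩ {z : ℂ | (D.pt 0).im < z.im} ⊆
        E ∪ ball (D.pt 0) (12 * ρ') ∪ ball (D.pt 1) (12 * ρ')} ⊆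
      {u : HexVertex | (δ : ℂ) * hexCenter u ∈ D.carrier ∧ m δ ≤ u.1 1 ∧
      closedBall ((δ : ℂ) * hexCenter u) (25 * δ) ∩ {z : ℂ | (D.pt 0).im < z.im} ⊆
        D.carrier ∪ ball (D.pt 0) (12 * ρ') ∪ ball (D.pt 1) (12 * ρ')} :=
    fun δ u ⟨h1, h2, h3⟩ => ⟨hED h1, h2,
      h3.trans (union_subset_union_left _ (union_subset_union_left _ hED))⟩
  -- endpoint limits and distinctness of the two mid-edges
  have hσa_t : Tendsto (fun δ : ℝ => (δ : ℂ) * hexMidpoint (σa δ)) (𝓝[>] 0) (𝓝 (D.pt 0)) :=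
    (tendsto_smul_hexMidpoint ha_t (Eventually.of_forall fun δ =>
      hexGraph_adj_floorNeighbour (a δ))).congr' (hσa.mono fun δ h => by simp only [h])
  have hσb_t : Tendsto (fun δ : ℝ => (δ : ℂ) * hexMidpoint (σb δ)) (𝓝[>] 0) (𝓝 (D.pt 1)) :=
    (tendsto_smul_hexMidpoint hb_t (Eventually.of_forall fun δ =>
      hexGraph_adj_floorNeighbour (b δ))).congr' (hσb.mono fun δ h => by simp only [h])
  have hσne := eventually_ne_of_tendsto_nhds (D.pt_injective.ne (by decide : (0 : Fin 2) ≠ 1)) hσa_t hσb_t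
  have hballa := eventually_adj_mem_ball hρ'0 ha_t
  have hballb := eventually_adj_mem_ball hρ'0 hb_t
  filter_upwards [Ioc_mem_nhdsGT hρ'0, hL, hLE, hLrows, hLErows, hend', haim,
    hballa, hballb, hσne, hσa, hσb] with δ hδ hA hA' hR hR' hE hIm hBa hBb hσ hσaδ hσbδ
  obtain ⟨hsc, hconn, hchar⟩ := hA
  obtain ⟨hsc', hconn', hchar'⟩ := hA'
  have hΛS : ∀ v ∈ L δ, (δ : ℂ) * hexCenter v ∈ D.carrier ∧ m δ ≤ v.1 1 := fun v hv =>
    ⟨((hchar v).1 hv).right_mem.1, ((hchar v).1 hv).right_mem.2.1⟩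
  have hΛ'S : ∀ v ∈ LE δ, (δ : ℂ) * hexCenter v ∈ E ∧ m δ ≤ v.1 1 := fun v hv =>
    ⟨((hchar' v).1 hv).right_mem.1, ((hchar' v).1 hv).right_mem.2.1⟩
  have hΛ'Λ : LE δ ⊆ L δ := fun z hz => (hchar z).2 (((hchar' z).1 hz).mono (hSS δ))
  obtain ⟨⟨ua, hua, huaim⟩, ⟨ub, hub, hubim⟩⟩ := hE
  rw [hpt] at hubim
  obtain ⟨ia, oa, hσa_eq, hia, hoa, hoia, -, -, -⟩ := floor_endpoint_data hδ.1
    (hm δ hδ.1).1 (hm δ hδ.1).2 hua hIm.1 huaim hDh hΛS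
    (fun v hvm hvb => hR' v (Or.inl hvb) hvm) hBa
  obtain ⟨ib, ob, hσb_eq, hib, hob, hoib, -, -, -⟩ := floor_endpoint_data hδ.1
    (hm δ hδ.1).1 (hm δ hδ.1).2 hub hIm.2 hubim hDh hΛS
    (fun v hvm hvb => hR' v (Or.inr hvb) hvm) hBb
  have hσne' : s(oa, ia) ≠ s(ob, ib) := by
    intro heq
    apply hσ
    rw [hσaδ, hσbδ, hσa_eq, hσb_eq, heq]
  rw [hσaδ, hσbδ, hσa_eq, hσb_eq]
  refine ⟨hΛ'Λ, hsc, hsc', hconn, hconn',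
    (mem_hexDomainBoundary_of_adj (hΛ'Λ hia) hoa hoia.symm).2,
    (mem_hexDomainBoundary_of_adj (hΛ'Λ hib) hob hoib.symm).2,
    (mem_hexDomainBoundary_of_adj hia (fun h => hoa (hΛ'Λ h)) hoia.symm).2,
    (mem_hexDomainBoundary_of_adj hib (fun h => hob (hΛ'Λ h)) hoib.symm).2,
    nonempty_hexMidEdgeSAW_of_preconnected hconn' hoia (fun h => hoa (hΛ'Λ h)) hia
      (fun h => hob (hΛ'Λ h)) hib hσne',
    hΛS, fun v hv => (hΛ'S v hv).1, fun v hv => ?_⟩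
  exact ⟨⟨fun h => (hΛS v h).2, fun h => hR v hv h⟩, ⟨fun h => (hΛ'S v h).2, fun h => hR' v hv h⟩⟩

/-- **The margin lemma**: `Λ''` (the `D'`-component of the bulk vertex in `Λ`) eventually lies in
the inner family of any `E ⊇ D'` swallowing the points of `D` within `η` of `D'`. [folklore] -/
theorem eventually_subset_of_margin {D : DobrushinDomain} {D' E : Set ℂ} {ρ' η : ℝ}
    {m : ℝ → ℤ} {v₀ : ℝ → HexVertex} {Λ Λ'' LE : ℝ → Finset HexVertex}
    (hD'E : D' ⊆ E) (hη : 0 < η)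
    (hmargin : ∀ z ∈ D.carrier, Metric.infDist z D' ≤ η → z ∈ E)
    (hΛ : ∀ᶠ δ : ℝ in 𝓝[>] 0, ∀ z : HexVertex, z ∈ Λ δ ↔ PathIn hexGraph
        {u : HexVertex | (δ : ℂ) * hexCenter u ∈ D.carrier ∧ m δ ≤ u.1 1 ∧
          closedBall ((δ : ℂ) * hexCenter u) (25 * δ) ∩ {z : ℂ | (D.pt 0).im < z.im} ⊆
            D.carrier ∪ ball (D.pt 0) (12 * ρ') ∪ ball (D.pt 1) (12 * ρ')} (v₀ δ) z)
    (hΛ'' : ∀ᶠ δ : ℝ in 𝓝[>] 0, ∀ z : HexVertex, z ∈ Λ'' δ ↔ z ∈ Λ δ ∧ PathIn hexGraph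
        {x : HexVertex | x ∈ Λ δ ∧ (δ : ℂ) * hexCenter x ∈ D'} (v₀ δ) z)
    (hLE : ∀ᶠ δ : ℝ in 𝓝[>] 0, ∀ z : HexVertex, z ∈ LE δ ↔ PathIn hexGraph
        {u : HexVertex | (δ : ℂ) * hexCenter u ∈ E ∧ m δ ≤ u.1 1 ∧
          closedBall ((δ : ℂ) * hexCenter u) (25 * δ) ∩ {z : ℂ | (D.pt 0).im < z.im} ⊆
            E ∪ ball (D.pt 0) (12 * ρ') ∪ ball (D.pt 1) (12 * ρ')} (v₀ δ) z) :
    ∀ᶠ δ : ℝ in 𝓝[>] 0, Λ'' δ ⊆ LE δ := by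
  filter_upwards [Ioc_mem_nhdsGT (show (0 : ℝ) < η / 25 by positivity), hΛ, hΛ'', hLE]
    with δ hδ hchar hchar'' hcharE z hz
  rw [hcharE]
  refine (((hchar'' z).1 hz).2).mono fun x hx => ?_
  obtain ⟨hxΛ, hxD'⟩ := hx
  obtain ⟨hxD, hxm, hxball⟩ := ((hchar x).1 hxΛ).right_mem
  refine ⟨hD'E hxD', hxm, fun y hy => ?_⟩
  rcases hxball hy with (hyD | hy₀) | hy₁
  · refine Or.inl (Or.inl (hmargin y hyD ?_))
    calc Metric.infDist y D' ≤ dist y ((δ : ℂ) * hexCenter x) := Metric.infDist_le_dist_of_mem hxD'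
      _ ≤ 25 * δ := mem_closedBall.1 hy.1
      _ ≤ η := by linarith [hδ.2]
  · exact Or.inl (Or.inr hy₀)
  · exact Or.inr hy₁

/-- A ratio `≥ 1` eventually below quantities converging to at most `1 + ε`, `∀ ε > 0`, tends to `1`. [folklore] -/
theorem tendsto_one_of_ratio_squeeze {l : Filter ℝ} {r : ℝ → ℝ} (h1 : ∀ᶠ δ in l, 1 ≤ r δ)
    (h2 : ∀ ε : ℝ, 0 < ε → ∃ (g : ℝ → ℝ) (c : ℝ), c ≤ 1 + ε ∧ Tendsto g l (𝓝 c) ∧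
      ∀ᶠ δ in l, r δ ≤ g δ) : Tendsto r l (𝓝 1) := by
  refine Metric.tendsto_nhds.2 fun ε hε => ?_
  obtain ⟨g, c, hc, hg, hrg⟩ := h2 (ε / 2) (half_pos hε)
  filter_upwards [h1, hrg, Metric.tendsto_nhds.1 hg _ (half_pos hε)] with δ hr1 hrg hgc
  rw [Real.dist_eq, abs_sub_lt_iff] at hgc ⊢
  constructor <;> linarith [hgc.1]

/-- **(M2'b) FROM HULL APPROXIMATION**: under the cocycle, if the hull subdomain `D'` is
approximated from outside by hull subdomains `D'' ⊇ D'` swallowing a metric collar of `D'` with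
`Φ'_{A''}(0)^{5/8} ≤ (1 + ε) Φ'_A(0)^{5/8}`, then for the transparent data of `discretisation_core`
`Z_{Λ''δ}(σa, σb) / Z_{Λ'δ}(σa, σb) → 1`. [cite: LawlerSchrammWerner2004SAW, §3.4 ("SAW satisfies restriction")] -/
theorem insensitivity_of_hullApprox :
    (∀ (D D' : DobrushinDomain) (ρ : ℝ) (φ : ConformalEquiv upperHalfPlaneSet D.carrier)
    (Φ : ConformalEquiv (upperHalfPlaneSet \ φ.pullbackHull D') upperHalfPlaneSet) (d : ℝ)
    (Λ Λ' : ℝ → Finset HexVertex) (m : ℝ → ℤ) (a b : ℝ → Sym2 HexVertex),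
    (0 < ρ ∧ (D.pt 1).im = (D.pt 0).im ∧ D.carrier ⊆ {z : ℂ | (D.pt 0).im < z.im} ∧
    D.carrier ∩ ball (D.pt 0) ρ = {z : ℂ | (D.pt 0).im < z.im} ∩ ball (D.pt 0) ρ ∧
    D.carrier ∩ ball (D.pt 1) ρ = {z : ℂ | (D.pt 1).im < z.im} ∩ ball (D.pt 1) ρ) → D.IsHullSubdomain D' → D.IsChordalUniformizing φ →
    IsRestrictionMap (φ.pullbackHull D') Φ → HasRestrictionDeriv (φ.pullbackHull D') Φ d →
    (∀ᶠ δ : ℝ in 𝓝[>] 0,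
    Λ' δ ⊆ Λ δ ∧ hexDomainSimplyConnected (Λ δ) ∧ hexDomainSimplyConnected (Λ' δ) ∧
    (hexGraph.induce (↑(Λ δ) : Set HexVertex)).Preconnected ∧
    (hexGraph.induce (↑(Λ' δ) : Set HexVertex)).Preconnected ∧
    a δ ∈ hexDomainBoundary (Λ δ) ∧ b δ ∈ hexDomainBoundary (Λ δ) ∧
    a δ ∈ hexDomainBoundary (Λ' δ) ∧ b δ ∈ hexDomainBoundary (Λ' δ) ∧
    Nonempty (HexMidEdgeSAW (Λ' δ) (a δ) (b δ)) ∧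
    (∀ v ∈ Λ δ, (δ : ℂ) * hexCenter v ∈ D.carrier ∧ m δ ≤ v.1 1) ∧
    (∀ v ∈ Λ' δ, (δ : ℂ) * hexCenter v ∈ D'.carrier) ∧
    (∀ v : HexVertex, (δ : ℂ) * hexCenter v ∈ ball (D.pt 0) ρ ∪ ball (D.pt 1) ρ →
    ((v ∈ Λ δ ↔ m δ ≤ v.1 1) ∧ (v ∈ Λ' δ ↔ m δ ≤ v.1 1)))) →
    (∀ K : Set ℂ, IsCompact K → K ⊆ D.carrier →
    ∀ᶠ δ : ℝ in 𝓝[>] 0, ∀ v : HexVertex, (δ : ℂ) * hexCenter v ∈ K → v ∈ Λ δ) →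
    (∀ K : Set ℂ, IsCompact K → K ⊆ D'.carrier →
    ∀ᶠ δ : ℝ in 𝓝[>] 0, ∀ v : HexVertex, (δ : ℂ) * hexCenter v ∈ K → v ∈ Λ' δ) →
    Tendsto (fun δ : ℝ => (δ : ℂ) * hexMidpoint (a δ)) (𝓝[>] 0) (𝓝 (D.pt 0)) →
    Tendsto (fun δ : ℝ => (δ : ℂ) * hexMidpoint (b δ)) (𝓝[>] 0) (𝓝 (D.pt 1)) →
    Tendsto (fun δ : ℝ => (∑ γ : HexMidEdgeSAW (Λ' δ) (a δ) (b δ), hexCriticalFugacity ^ γ.length) /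
    (∑ γ : HexMidEdgeSAW (Λ δ) (a δ) (b δ), hexCriticalFugacity ^ γ.length)) (𝓝[>] 0)
    (𝓝 (d ^ ((5 : ℝ) / 8)))) →
    ∀ (D D' : DobrushinDomain) (ρ ρ' : ℝ) (a b : ℝ → HexVertex) (Λ Λ' Λ'' : ℝ → Finset HexVertex)
    (m : ℝ → ℤ) (σa σb : ℝ → Sym2 HexVertex) (v₀ : ℝ → HexVertex),
    (0 < ρ ∧ (D.pt 1).im = (D.pt 0).im ∧ D.carrier ⊆ {z : ℂ | (D.pt 0).im < z.im} ∧
    D.carrier ∩ ball (D.pt 0) ρ = {z : ℂ | (D.pt 0).im < z.im} ∩ ball (D.pt 0) ρ ∧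
    D.carrier ∩ ball (D.pt 1) ρ = {z : ℂ | (D.pt 1).im < z.im} ∩ ball (D.pt 1) ρ) →
    D.IsHullSubdomain D' →
    (IsEmbEndpointApprox hexGraph hexCenter D a b ∧ ∀ᶠ δ : ℝ in 𝓝[>] 0,
    (∃ u : HexVertex, hexGraph.Adj (a δ) u ∧ ((δ : ℂ) * hexCenter u).im ≤ (D.pt 0).im) ∧
    (∃ u : HexVertex, hexGraph.Adj (b δ) u ∧ ((δ : ℂ) * hexCenter u).im ≤ (D.pt 1).im)) →
    -- hull approximation of `D'` from outside
    (∀ (φ : ConformalEquiv upperHalfPlaneSet D.carrier)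
      (Φ : ConformalEquiv (upperHalfPlaneSet \ φ.pullbackHull D') upperHalfPlaneSet) (d : ℝ),
      D.IsChordalUniformizing φ → IsRestrictionMap (φ.pullbackHull D') Φ →
      HasRestrictionDeriv (φ.pullbackHull D') Φ d →
      ∀ ε : ℝ, 0 < ε → ∃ (D'' : DobrushinDomain)
        (Φ'' : ConformalEquiv (upperHalfPlaneSet \ φ.pullbackHull D'') upperHalfPlaneSet) (d'' η : ℝ),
        D.IsHullSubdomain D'' ∧ D'.carrier ⊆ D''.carrier ∧ 0 < η ∧
        (∀ z ∈ D.carrier, Metric.infDist z D'.carrier ≤ η → z ∈ D''.carrier) ∧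
        IsRestrictionMap (φ.pullbackHull D'') Φ'' ∧ HasRestrictionDeriv (φ.pullbackHull D'') Φ'' d'' ∧
        d'' ^ ((5 : ℝ) / 8) ≤ (1 + ε) * d ^ ((5 : ℝ) / 8)) →
    -- the transparent discretisation data
    0 < ρ' →
    (∀ δ : ℝ, 0 < δ → ((m δ : ℝ) - 2 / 3) * (δ * (Real.sqrt 3 / 2)) ≤ (D.pt 0).im ∧
      (D.pt 0).im < ((m δ : ℝ) + 1 / 3) * (δ * (Real.sqrt 3 / 2))) →
    ({z : ℂ | (D.pt 0).im < z.im} ∩ ball (D.pt 0) (16 * ρ') ⊆ D'.carrier) →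
    ({z : ℂ | (D.pt 0).im < z.im} ∩ ball (D.pt 1) (16 * ρ') ⊆ D'.carrier) →
    (∀ δ : ℝ, 0 < δ →
      dist ((δ : ℂ) * hexCenter (v₀ δ)) (D.pt 0 + ((4 * ρ' : ℝ) : ℂ) * Complex.I) ≤ δ) →
    (∀ᶠ δ : ℝ in 𝓝[>] 0, hexDomainSimplyConnected (Λ δ) ∧
      (hexGraph.induce (↑(Λ δ) : Set HexVertex)).Preconnected ∧
      ∀ z : HexVertex, z ∈ Λ δ ↔ PathIn hexGraph
        {u : HexVertex | (δ : ℂ) * hexCenter u ∈ D.carrier ∧ m δ ≤ u.1 1 ∧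
          closedBall ((δ : ℂ) * hexCenter u) (25 * δ) ∩ {z : ℂ | (D.pt 0).im < z.im} ⊆
            D.carrier ∪ ball (D.pt 0) (12 * ρ') ∪ ball (D.pt 1) (12 * ρ')} (v₀ δ) z) →
    (∀ᶠ δ : ℝ in 𝓝[>] 0, hexDomainSimplyConnected (Λ' δ) ∧
      (hexGraph.induce (↑(Λ' δ) : Set HexVertex)).Preconnected ∧
      ∀ z : HexVertex, z ∈ Λ' δ ↔ PathIn hexGraph
        {u : HexVertex | (δ : ℂ) * hexCenter u ∈ D'.carrier ∧ m δ ≤ u.1 1 ∧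
          closedBall ((δ : ℂ) * hexCenter u) (25 * δ) ∩ {z : ℂ | (D.pt 0).im < z.im} ⊆
            D'.carrier ∪ ball (D.pt 0) (12 * ρ') ∪ ball (D.pt 1) (12 * ρ')} (v₀ δ) z) →
    (∀ᶠ δ : ℝ in 𝓝[>] 0, ∀ z : HexVertex, z ∈ Λ'' δ ↔ z ∈ Λ δ ∧ PathIn hexGraph
        {x : HexVertex | x ∈ Λ δ ∧ (δ : ℂ) * hexCenter x ∈ D'.carrier} (v₀ δ) z) →
    (∀ᶠ δ : ℝ in 𝓝[>] 0, ∀ v : HexVertex,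
      (δ : ℂ) * hexCenter v ∈ ball (D.pt 0) ρ' ∪ ball (D.pt 1) ρ' → m δ ≤ v.1 1 →
        v ∈ Λ δ ∧ v ∈ Λ' δ) →
    (∀ K : Set ℂ, IsCompact K → K ⊆ D.carrier →
      ∀ᶠ δ : ℝ in 𝓝[>] 0, ∀ v : HexVertex, (δ : ℂ) * hexCenter v ∈ K → v ∈ Λ δ) →
    (∀ K : Set ℂ, IsCompact K → K ⊆ D'.carrier →
      ∀ᶠ δ : ℝ in 𝓝[>] 0, ∀ v : HexVertex, (δ : ℂ) * hexCenter v ∈ K → v ∈ Λ' δ) →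
    (∀ᶠ δ : ℝ in 𝓝[>] 0, σa δ = s(a δ, if (a δ).2 = 0 then
      (((a δ).1 - Pi.single 1 1, 1) : HexVertex) else ((a δ).1 + Pi.single 1 1, 0))) →
    (∀ᶠ δ : ℝ in 𝓝[>] 0, σb δ = s(b δ, if (b δ).2 = 0 then
      (((b δ).1 - Pi.single 1 1, 1) : HexVertex) else ((b δ).1 + Pi.single 1 1, 0))) →
    Tendsto (fun δ : ℝ =>
      (∑ γ : HexMidEdgeSAW (Λ'' δ) (σa δ) (σb δ), hexCriticalFugacity ^ γ.length) /
      (∑ γ : HexMidEdgeSAW (Λ' δ) (σa δ) (σb δ), hexCriticalFugacity ^ γ.length))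
      (𝓝[>] 0) (𝓝 1) := by
  intro H D D' ρ ρ' a b Λ Λ' Λ'' m σa σb v₀ hfl hD' hend HA hρ'0 hm hflD'0 hflD'1 hv₀ hΛ hΛ' hΛ''
    hrows hK hK' hσa hσb
  obtain ⟨hρ0, hpt, hDh, hfl0, hfl1⟩ := hfl
  obtain ⟨hab, hend'⟩ := hend
  have hD'D : D'.carrier ⊆ D.carrier := hD'.carrier_subset
  have hD'h : D'.carrier ⊆ {z : ℂ | (D.pt 0).im < z.im} := hD'D.trans hDh
  have hflD0 : {z : ℂ | (D.pt 0).im < z.im} ∩ ball (D.pt 0) (16 * ρ') ⊆ D.carrier :=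
    hflD'0.trans hD'D
  have hflD1 : {z : ℂ | (D.pt 0).im < z.im} ∩ ball (D.pt 1) (16 * ρ') ⊆ D.carrier :=
    hflD'1.trans hD'D
  -- the floor condition at radius `ρ'`
  have hflρ' : 0 < ρ' ∧ (D.pt 1).im = (D.pt 0).im ∧ D.carrier ⊆ {z : ℂ | (D.pt 0).im < z.im} ∧
      D.carrier ∩ ball (D.pt 0) ρ' = {z : ℂ | (D.pt 0).im < z.im} ∩ ball (D.pt 0) ρ' ∧
      D.carrier ∩ ball (D.pt 1) ρ' = {z : ℂ | (D.pt 1).im < z.im} ∩ ball (D.pt 1) ρ' := by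
    refine ⟨hρ'0, hpt, hDh, inter_ball_eq_of_flat hDh fun z hz => hflD0 ⟨hz.1, ?_⟩, ?_⟩
    · exact ball_subset_ball (by linarith) hz.2
    · rw [hpt]
      exact inter_ball_eq_of_flat hDh fun z hz => hflD1 ⟨hz.1, ball_subset_ball (by linarith) hz.2⟩
  -- uniformizer and restriction data of `D'`
  obtain ⟨φ, hφ⟩ := MarkedDomain.exists_isChordalUniformizing_holds D
  have hA : IsStarHull (φ.pullbackHull D') :=
    IsStarHull.pullbackHull JordanDomain.isSimplyConnected_holds hφ hD'
  obtain ⟨Φ, hΦ, -⟩ := IsStarHull.existsUnique_isRestrictionMap_holds hA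
  obtain ⟨d, hd0, -, hd⟩ := IsStarHull.exists_hasRestrictionDeriv_holds hA hΦ
  have hd58 : 0 < d ^ ((5 : ℝ) / 8) := Real.rpow_pos_of_pos hd0 _
  -- admissibility of `(Λ, Λ')` and the cocycle
  have haim := eventually_im_lt_of_endpointApprox hDh hab
  have hADM := pair_admissible (E := D'.carrier) hpt hDh hρ'0 hD'D hm hab.tendsto_fst hab.tendsto_snd
    haim hend' hσa hσb hΛ
    (hrows.mono fun δ h v hv hvm => (h v hv hvm).1) hΛ' (hrows.mono fun δ h v hv hvm => (h v hv hvm).2)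
  have hσa_t : Tendsto (fun δ : ℝ => (δ : ℂ) * hexMidpoint (σa δ)) (𝓝[>] 0) (𝓝 (D.pt 0)) :=
    (tendsto_smul_hexMidpoint hab.tendsto_fst (Eventually.of_forall fun δ =>
      hexGraph_adj_floorNeighbour (a δ))).congr' (hσa.mono fun δ h => by simp only [h])
  have hσb_t : Tendsto (fun δ : ℝ => (δ : ℂ) * hexMidpoint (σb δ)) (𝓝[>] 0) (𝓝 (D.pt 1)) :=
    (tendsto_smul_hexMidpoint hab.tendsto_snd (Eventually.of_forall fun δ =>
      hexGraph_adj_floorNeighbour (b δ))).congr' (hσb.mono fun δ h => by simp only [h])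
  have hT' := H D D' ρ' φ Φ d Λ Λ' m σa σb hflρ' hD' hφ hΦ hd hADM hK hK' hσa_t hσb_t
  -- `Λ' δ ⊆ Λ'' δ`, positivity
  have hpos : ∀ᶠ δ : ℝ in 𝓝[>] 0,
      0 < ∑ γ : HexMidEdgeSAW (Λ' δ) (σa δ) (σb δ), hexCriticalFugacity ^ γ.length ∧
      Λ' δ ⊆ Λ'' δ ∧ Λ'' δ ⊆ Λ δ := by
    filter_upwards [hADM, hΛ, hΛ', hΛ''] with δ hA hchar hchar' hchar''
    obtain ⟨-, -, -, -, -, -, -, -, -, hN, -⟩ := hA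
    have hSS : {u : HexVertex | (δ : ℂ) * hexCenter u ∈ D'.carrier ∧ m δ ≤ u.1 1 ∧
        closedBall ((δ : ℂ) * hexCenter u) (25 * δ) ∩ {z : ℂ | (D.pt 0).im < z.im} ⊆
          D'.carrier ∪ ball (D.pt 0) (12 * ρ') ∪ ball (D.pt 1) (12 * ρ')} ⊆
        {u : HexVertex | (δ : ℂ) * hexCenter u ∈ D.carrier ∧ m δ ≤ u.1 1 ∧
        closedBall ((δ : ℂ) * hexCenter u) (25 * δ) ∩ {z : ℂ | (D.pt 0).im < z.im} ⊆
          D.carrier ∪ ball (D.pt 0) (12 * ρ') ∪ ball (D.pt 1) (12 * ρ')} :=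
      fun u ⟨h1, h2, h3⟩ => ⟨hD'D h1, h2,
        h3.trans (union_subset_union_left _ (union_subset_union_left _ hD'D))⟩
    refine ⟨sum_pow_length_pos hN, fun z hz => ?_, fun z hz => ((hchar'' z).1 hz).1⟩
    rw [hchar'' z]
    refine ⟨(hchar.2.2 z).2 (((hchar'.2.2 z).1 hz).mono hSS), ?_⟩
    exact (pathIn_component ((hchar'.2.2 z).1 hz)).mono fun x hx =>
      ⟨(hchar.2.2 x).2 (hx.mono hSS), hx.right_mem.1⟩
  refine tendsto_one_of_ratio_squeeze (hpos.mono fun δ h => ?_) fun ε hε => ?_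
  · rw [le_div_iff₀ h.1, one_mul]
    exact sum_pow_length_mono h.2.1
  -- the approximation `D''`
  obtain ⟨D'', Φ'', d'', η, hD'', hD'D'', hη, hmargin, hΦ'', hd'', hle⟩ := HA φ Φ d hφ hΦ hd ε hε
  have hD''D : D''.carrier ⊆ D.carrier := hD''.carrier_subset
  have hD''h : D''.carrier ⊆ {z : ℂ | (D.pt 0).im < z.im} := hD''D.trans hDh
  have hE'' := D''.toJordanDomain.isConnected_compl_closure
    Literature.Topology.PlaneTopology.JordanCurveTheorem_holds
  have hv₀' : ∀ δ : ℝ, 0 < δ →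
      dist ((δ : ℂ) * hexCenter (v₀ δ)) (D.pt 0 + ((16 * ρ' / 4 : ℝ) : ℂ) * Complex.I) ≤ δ := by
    intro δ hδ
    rw [show 16 * ρ' / 4 = 4 * ρ' by ring]
    exact hv₀ δ hδ
  obtain ⟨LE, hLEall, hLEK, hLErows⟩ := exists_innerFamily D''.isOpen D''.isConnected D''.isBounded
    hD''h hE''.1 hE''.2 rfl hpt (by positivity : (0 : ℝ) < 16 * ρ') (hflD'0.trans hD'D'')
    (hflD'1.trans hD'D'') hm hv₀'
  have e12 : 3 * (16 * ρ') / 4 = 12 * ρ' := by ring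
  have e1 : 16 * ρ' / 16 = ρ' := by ring
  rw [e12] at hLEall
  rw [e1] at hLErows
  have hADM'' := pair_admissible (E := D''.carrier) hpt hDh hρ'0 hD''D hm hab.tendsto_fst
    hab.tendsto_snd haim hend' hσa hσb hΛ
    (hrows.mono fun δ h v hv hvm => (h v hv hvm).1) hLEall
    (hLErows.mono fun δ h v hv hvm => h v hvm hv)
  have hT'' := H D D'' ρ' φ Φ'' d'' Λ LE m σa σb hflρ' hD'' hφ hΦ'' hd'' hADM'' hK hLEK hσa_t hσb_t
  have hsub := eventually_subset_of_margin (D := D) hD'D'' hη hmargin (hΛ.mono fun δ h => h.2.2) hΛ''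
    (hLEall.mono fun δ h => h.2.2)
  refine ⟨fun δ => ((∑ γ : HexMidEdgeSAW (LE δ) (σa δ) (σb δ), hexCriticalFugacity ^ γ.length) /
      (∑ γ : HexMidEdgeSAW (Λ δ) (σa δ) (σb δ), hexCriticalFugacity ^ γ.length)) /
      ((∑ γ : HexMidEdgeSAW (Λ' δ) (σa δ) (σb δ), hexCriticalFugacity ^ γ.length) /
      (∑ γ : HexMidEdgeSAW (Λ δ) (σa δ) (σb δ), hexCriticalFugacity ^ γ.length)),
    d'' ^ ((5 : ℝ) / 8) / d ^ ((5 : ℝ) / 8), ?_, hT''.div hT' hd58.ne', ?_⟩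
  · rwa [div_le_iff₀ hd58]
  · filter_upwards [hpos, hsub] with δ h hs
    have hΛpos : 0 < ∑ γ : HexMidEdgeSAW (Λ δ) (σa δ) (σb δ), hexCriticalFugacity ^ γ.length :=
      h.1.trans_le (sum_pow_length_mono (h.2.1.trans h.2.2))
    rw [div_div_div_cancel_right₀ hΛpos.ne']
    exact div_le_div_of_nonneg_right (sum_pow_length_mono hs) h.1.le

end Insensitivity

/-- **Registered sub-goal `stub_canonicalTransfer_ratioSqueeze`** (crux item
stmt-CriticalPhenomena-10472, stub `stub_canonicalTransfer`): registry form of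
`tendsto_one_of_ratio_squeeze`, the limit step of (M2'b). [folklore] -/
theorem stub_canonicalTransfer_ratioSqueeze :
    ∀ (l : Filter ℝ) (r : ℝ → ℝ), (∀ᶠ δ in l, 1 ≤ r δ) →
    (∀ ε : ℝ, 0 < ε → ∃ (g : ℝ → ℝ) (c : ℝ), c ≤ 1 + ε ∧ Tendsto g l (𝓝 c) ∧
      ∀ᶠ δ in l, r δ ≤ g δ) → Tendsto r l (𝓝 1) :=
  fun _ _ h1 h2 => tendsto_one_of_ratio_squeeze h1 h2

end Summit.CriticalPhenomena.SAWScalingLimit.Theorems.ObservableToSLE.FloorRatio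
end
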